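import Literature.AlgebraicGeometry.ComplexMultiplication.MumfordTateTorusAbelianVarietyKubotaRank
import Literature.Geometry.Kaehler.ComplexTorusPicardNumberGapsGeneral
import HarnessLib

/-!
# Abelian varieties of CM-type, structure-free (IV): the PICARD NUMBER `ρ(A) = [End⁰(A):ℚ]/2` — hence
# `dim A ≤ ρ(A)`, `ρ(A) = dim A` iff `End⁰(A)` is commutative (e.g. `A` simple), and `ρ(Aᵏ) = k² ρ(A)`

Topic `Literature/AlgebraicGeometry/ComplexMultiplication`; namespace `Literature.Geometry.Kaehler.ComplexTorus.IsAbelianVariety`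
(dot notation on `hX : IsAbelianVariety P`).  Lane `lit-hodgefound` (Track 2 foundations library), seat p19 generation
29, row g29-#3 — sequel of `MumfordTateTorusAbelianVarietyKubotaRank.lean` (g29-#1 §1: the simple-CM-factor model
`A ∼ ∏ⱼ Bⱼ^{mⱼ}`, `End⁰(Bⱼ) ≅ Kⱼ` CM fields, `[End⁰A:ℚ] = Σⱼ mⱼ²[Kⱼ:ℚ]`; §2: `[End⁰A:ℚ] = 2 dim A ⟺ End⁰(A)` commutative).
The Picard number `ρ(A) = rk NS(A)` (the tree's `ComplexTorus.neronSeveriGroup`, `ρ = dim_ℚ H²_Hodge`,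
`finrank_neronSeveriGroup_eq_finrank_hodgeClasses`) is computed STRUCTURE-FREE for every abelian variety `A` whose
Mumford–Tate group `MT(A)(ℂ)` is a torus (Deligne's «of CM-type»), by summing the tree's isotypic ingredients BY NAME:
isogeny invariance (`IsIsogenous.finrank_neronSeveriGroup_eq`), Hulek–Laface Cor. 2.3 for simple pairwise
non-isogenous factors (`finrank_neronSeveriGroup_powers`), the power formula `ρ(Xᵏ) = kρ(X) + C(k,2)[End_ℚX:ℚ]`
(`IsAbelianVariety.finrank_neronSeveriGroup_pow`), and `ρ(ℂ^Φ/u(𝔪)) = [K:ℚ]/2` for a simple CM torus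
(`CMTorus.finrank_neronSeveriGroup_eq_of_isSimple`, Pohlmann's count).  THEOREMS ONLY: no definition, no instance, no
named fact (D-0026 net debt `0`).

## The print

* K. Hulek, R. Laface, *On the Picard numbers of abelian varieties*, Ann. Sc. Norm. Super. Pisa (2019)
  [HulekLaface2019PicardNumbersAV], held `paper:arxiv-1703.05882` p0006: **Prop. 2.4** (Murty) «Let `A` be a simple
  abelian variety. Set `e := [K : ℚ]`, `d² := [F : K]`. Then, for `k ≥ 1`, one has `ρ(Aᵏ) = … ½ e d² k²` (Type IV).»;
  **Cor. 2.3** «Let `A_1, …, A_r` be simple abelian varieties, such that `A_i` is not isogenous to `A_j` for `i ≠ j`.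
  Then, `ρ(∏_{i=1}^r A_i^{n_i}) = Σ_{i=1}^r ρ(A_i^{n_i})`» (both as quoted in the tree's
  `ComplexTorusPicardNumberAlbertTypes` / `ComplexTorusPicardNumberPoincareLength`).
* H. Lange, *Abelian Varieties over the Complex Numbers* (2023) [Lange2023AbelianVarietiesComplex], §2.6.1 Proposition
  (p. 138), table line 4: «`(F, ′)` of the second kind ∣ … ∣ `ρ = e₀d²`», proof «recall from Proposition 2.4.12 that
  `ρ = dim_ℝ End^s_ℚ(X) ⊗_ℚ ℝ` … Finally in the last case … `ρ = e₀d²`»; §2.4.4 Cor. 2.4.26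
  («`End_ℚ(X) ≅ M_{n_1}(F_1) ⊕ ⋯ ⊕ M_{n_r}(F_r)`»).
* B. B. Gordon [Gordon1999HodgeAVSurvey] 9.2.2 «`A` simple, `B¹(A) ≅ K₀`» (`ρ(A) = [K₀:ℚ] = dim A` for a simple CM abelian
  variety); §2 Prop. 2.12 of [Gordon1997] («of CM-type iff `Hg(A)` is an algebraic torus»).
* G. Shimura [Shimura1998] §5.1 Props. 3, 4, 6 (pp. 36–38: «`B × ⋯ × B`», «`2n = fgh`», «`g = 1` and `End_Q(B) = K`»);
  P. Deligne [Deligne1982HodgeCycles] I §5 Prop. 5.1 (p. 53).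
For `A` of CM-type every simple factor `Bⱼ` is of type IV with `d = 1`, `e = [Kⱼ:ℚ] = 2 dim Bⱼ`, `e₀ = dim Bⱼ`, so
`ρ(Bⱼ^{mⱼ}) = ½ e · mⱼ² = mⱼ²[Kⱼ:ℚ]/2` and `ρ(A) = Σⱼ mⱼ²[Kⱼ:ℚ]/2 = [End⁰A:ℚ]/2`.

## What is proved (all sorry-free; `X = E/P(ℤ^ι)`, `2 dim X = #ι`; hypotheses `hX : IsAbelianVariety P`,
## `hT : IsTorusSubgroup (mumfordTateGroupC P)`, `#ι > 0`; §3 repeats headlines from «`Hg(A)(ℂ)` is a torus»)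

§1 **`two_mul_finrank_neronSeveriGroup_eq_finrank_endAlgRat_of_isTorusSubgroup_mumfordTateGroupC`**
`: 2 * finrank ℤ (neronSeveriGroup P) = finrank ℚ (endAlgRat P)` — **`2ρ(A) = [End⁰(A):ℚ]`**; the same for
`dim_ℚ H²_Hodge(A)` (`two_mul_finrank_hodgeClasses_one_eq_finrank_endAlgRat_…`).
§2 **`card_le_two_mul_finrank_neronSeveriGroup_…`** (`dim A ≤ ρ(A)`); **`two_mul_finrank_neronSeveriGroup_eq_card_iff_comm_…`**
(`ρ(A) = dim A ⟺ End⁰(A)` commutative ⟺ `A` multiplicity-free) and the strict form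
`card_lt_two_mul_finrank_neronSeveriGroup_iff_not_comm_…`; **`two_mul_finrank_neronSeveriGroup_eq_card_of_isSimple_…`**
(`A` SIMPLE ⟹ `ρ(A) = dim A`, Gordon 9.2.2); **`finrank_neronSeveriGroup_powPeriod_eq_sq_mul_…`** (**`ρ(Aᵏ) = k² ρ(A)`**) and
`two_mul_finrank_neronSeveriGroup_powPeriod_eq_of_isSimple_…` (`ρ(Aᵏ) = k² dim A` for `A` simple, Prop. 2.4 Type IV);
`finrank_center_endAlgRat_le_two_mul_finrank_neronSeveriGroup_…` (`rdim A ≤ ρ(A)`).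
-/

open scoped Classical
open NumberField Module

namespace Literature.Geometry.Kaehler.ComplexTorus

open Literature.AlgebraicGeometry.Motives (CMType)
open Literature.AlgebraicGeometry.ComplexMultiplication (CMTorus.periodEquiv)
open Literature.AlgebraicGeometry.ComplexMultiplication.CMTorus
open Literature.NumberTheory.ComplexMultiplication (IsPrimitive IsCMAlgTorusRat)
open scoped Literature.NumberTheory.ComplexMultiplication
open Literature.NumberTheory.Automorphic (IsTorusSubgroup)

variable {ι : Type} [Fintype ι] [DecidableEq ι] {E : Type} [NormedAddCommGroup E] [NormedSpace ℂ E]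
  {P : (ι → ℝ) ≃L[ℝ] E}

/-! ### §0 Arithmetic of the isotypic factor: `2 (m·g + C(m,2)·2g) = m²·2g` -/

/-- `ρ(Bᵐ) = m ρ(B) + C(m,2) [End⁰B:ℚ]` with `ρ(B) = g`, `[End⁰B:ℚ] = 2g` gives `2ρ(Bᵐ) = m² · 2g`.
[cite: HulekLaface2019PicardNumbersAV, §2.1 Prop. 2.4 (Type IV: `ρ(Aᵏ) = ½ e d² k²`)] -/
private theorem two_mul_isotypic_picard (m g : ℕ) : 2 * (m * g + m.choose 2 * (g + g)) = m ^ 2 * (g + g) := by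
  have key : m.choose 2 * 2 = m * (m - 1) := by
    rw [Nat.choose_two_right]
    exact Nat.div_two_mul_two_of_even (Nat.even_mul_pred_self m)
  rcases Nat.eq_zero_or_pos m with rfl | hm
  · simp
  · obtain ⟨k, rfl⟩ : ∃ k, m = k + 1 := ⟨m - 1, (Nat.sub_add_cancel hm).symm⟩
    rw [Nat.add_sub_cancel] at key
    have h2 : (k + 1).choose 2 * (g + g) = (k + 1) * k * g := by
      rw [← two_mul, ← mul_assoc, key]
    rw [h2]
    ring

/-! ### §1 `2 ρ(A) = [End⁰(A) : ℚ]` for an abelian variety of CM-type -/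

namespace IsAbelianVariety

-- budget: destructuring the prequel's 19-clause model; headroom ×2
set_option maxHeartbeats 400000 in
/-- **THE PICARD NUMBER OF AN ABELIAN VARIETY OF CM-TYPE: `2 ρ(A) = [End⁰(A) : ℚ]`.**  For an abelian variety `A` of
positive dimension whose Mumford–Tate group is a torus (Deligne: «of CM-type»), `A ∼ ∏ⱼ Bⱼ^{mⱼ}` with simple,
pairwise non-isogenous CM factors `Bⱼ = ℂ^{Φⱼ}/u(𝔪ⱼ)`, `End⁰(Bⱼ) = Kⱼ` a CM field (type IV with `d = 1`, `e = [Kⱼ:ℚ]`,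
`e₀ = dim Bⱼ`): «`ρ(∏ᵢ Aᵢ^{nᵢ}) = Σᵢ ρ(Aᵢ^{nᵢ})`» (Hulek–Laface Cor. 2.3), «Type IV: `ρ(Aᵏ) = ½ e d² k²`» (Prop. 2.4),
so `ρ(A) = Σⱼ mⱼ² [Kⱼ:ℚ]/2 = [End⁰A:ℚ]/2` since `End⁰(A) ≃ Πⱼ M_{mⱼ}(Kⱼ)` — in the table of [Lange 2023, §2.6.1]:
«`(F, ′)` of the second kind … `ρ = e₀d²`» summed over the isotypic components (`ρ` is an isogeny invariant).
[cite: HulekLaface2019PicardNumbersAV, §2.1 Cor. 2.3 and Prop. 2.4] [cite: Lange2023AbelianVarietiesComplex, §2.6.1 Proposition, table line 4 (p. 138); §2.4.4 Cor. 2.4.26]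
[cite: Shimura1998, §5.1 Props. 3, 4, 6, pp. 36–38] [cite: Gordon1999HodgeAVSurvey, 9.2.2 («`A` simple, `B¹(A) ≅ K₀`»)]
[cite: Deligne1982HodgeCycles, I §5 Prop. 5.1, p. 53] -/
theorem two_mul_finrank_neronSeveriGroup_eq_finrank_endAlgRat_of_isTorusSubgroup_mumfordTateGroupC
    [Literature.AlgebraicGeometry.Motives.HodgeTensorFacts.{0, 0}] [Nonempty ι]
    (hX : IsAbelianVariety P) (hT : IsTorusSubgroup (mumfordTateGroupC P)) :
    2 * finrank ℤ (neronSeveriGroup P) = finrank ℚ (endAlgRat P) := by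
  obtain ⟨s, _, K, _, _, Φ, m, hCM, -, hsimple, hAV, hEK, hne, -, -, hiso, -, -, hd, -, -, -, -, -⟩ :=
    hX.exists_simple_cm_factors_isSeparatingFamily_of_isTorusSubgroup_mumfordTateGroupC hT
  -- `ρ(A) = ρ(∏ⱼ Bⱼ^{mⱼ}) = Σⱼ ρ(Bⱼ^{mⱼ})` (isogeny invariance; Hulek–Laface Cor. 2.3)
  rw [hiso.finrank_neronSeveriGroup_eq _ _,
    finrank_neronSeveriGroup_powers (fun j ↦ periodEquiv (Φ j) (finBasis ℚ (K j))) m hsimple hAV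
      (fun j j' hjj hij ↦ hjj ((hne j j').1 hij)),
    hd, Finset.mul_sum]
  refine Finset.sum_congr rfl fun j _ ↦ ?_
  -- `ρ(Bⱼ^{mⱼ}) = mⱼ ρ(Bⱼ) + C(mⱼ,2)[End⁰Bⱼ:ℚ]`, `ρ(Bⱼ) = [Kⱼ:ℚ]/2`, `[End⁰Bⱼ:ℚ] = [Kⱼ:ℚ]` even
  haveI := hCM j
  obtain ⟨e⟩ := hEK j
  rw [(hAV j).finrank_neronSeveriGroup_pow (m j), finrank_neronSeveriGroup_eq_of_isSimple (Φ j) (finBasis ℚ (K j))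
    (hsimple j), ← e.toLinearEquiv.finrank_eq]
  haveI : IsTotallyComplex (K j) := (hCM j).to_isTotallyComplex
  have heven : Even (finrank ℚ (K j)) := by
    rw [IsTotallyComplex.finrank (K := K j)]
    exact even_two_mul _
  obtain ⟨g, hg⟩ := heven
  rw [hg, show (g + g) / 2 = g by omega]
  exact two_mul_isotypic_picard (m j) g

/-- The same on `ℚ`-Hodge classes of codimension one: **`2 dim_ℚ H²_Hodge(A) = [End⁰(A):ℚ]`** (`ρ(A) = dim_ℚ H²_Hodge(A)`,
Lefschetz `(1,1)` for tori). [cite: Lange2023AbelianVarietiesComplex, §1.3.1 Exercise 1.3.4 (10)(b); §2.6.1 Proposition, table line 4]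
[cite: HulekLaface2019PicardNumbersAV, §2.1 Cor. 2.3 and Prop. 2.4] -/
theorem two_mul_finrank_hodgeClasses_one_eq_finrank_endAlgRat_of_isTorusSubgroup_mumfordTateGroupC
    [Literature.AlgebraicGeometry.Motives.HodgeTensorFacts.{0, 0}] [Nonempty ι]
    (hX : IsAbelianVariety P) (hT : IsTorusSubgroup (mumfordTateGroupC P)) :
    2 * finrank ℚ (hodgeClasses P 1) = finrank ℚ (endAlgRat P) := by
  rw [← finrank_neronSeveriGroup_eq_finrank_hodgeClasses]
  exact hX.two_mul_finrank_neronSeveriGroup_eq_finrank_endAlgRat_of_isTorusSubgroup_mumfordTateGroupC hT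

/-! ### §2 Consequences: `dim A ≤ ρ(A)`, `ρ(A) = dim A ⟺ End⁰(A) commutative`, `A` simple ⟹ `ρ(A) = dim A`,
`ρ(Aᵏ) = k² ρ(A)` -/

/-- **`dim A ≤ ρ(A)` for an abelian variety of CM-type** (`2 dim A ≤ [End⁰A:ℚ] = 2ρ(A)`: «`End⁰(A)` contains a commutative
semisimple subalgebra of degree `2 dim A`»). [cite: Gordon1997, §2 Prop. 2.12 (proof)] [cite: Shimura1998, §5.1 Prop. 6, p. 38]
[cite: HulekLaface2019PicardNumbersAV, §2.1 Prop. 2.4] -/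
theorem card_le_two_mul_finrank_neronSeveriGroup_of_isTorusSubgroup_mumfordTateGroupC
    [Literature.AlgebraicGeometry.Motives.HodgeTensorFacts.{0, 0}] [Nonempty ι]
    (hX : IsAbelianVariety P) (hT : IsTorusSubgroup (mumfordTateGroupC P)) :
    Fintype.card ι ≤ 2 * finrank ℤ (neronSeveriGroup P) := by
  rw [hX.two_mul_finrank_neronSeveriGroup_eq_finrank_endAlgRat_of_isTorusSubgroup_mumfordTateGroupC hT]
  exact hX.card_le_finrank_endAlgRat_of_isTorusSubgroup_mumfordTateGroupC hT

/-- **`ρ(A) = dim A` iff `End⁰(A)` is COMMUTATIVE** (iff `A` is multiplicity-free, `A ∼ ∏ⱼ Bⱼ`), for an abelian variety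
of CM-type (`2ρ(A) = [End⁰A:ℚ]`, and `[End⁰A:ℚ] = 2 dim A ⟺ End⁰(A)` commutative, Prop. 5.1 summed over the factors).
[cite: Lange2023AbelianVarietiesComplex, §2.6.1 Proposition, table line 4 (`ρ = e₀d²`)] [cite: HulekLaface2019PicardNumbersAV, §2.1 Cor. 2.3]
[cite: Deligne1982HodgeCycles, I §5 Prop. 5.1, p. 53] -/
theorem two_mul_finrank_neronSeveriGroup_eq_card_iff_comm_of_isTorusSubgroup_mumfordTateGroupC
    [Literature.AlgebraicGeometry.Motives.HodgeTensorFacts.{0, 0}] [Nonempty ι]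
    (hX : IsAbelianVariety P) (hT : IsTorusSubgroup (mumfordTateGroupC P)) :
    2 * finrank ℤ (neronSeveriGroup P) = Fintype.card ι ↔ ∀ a b : endAlgRat P, a * b = b * a := by
  rw [hX.two_mul_finrank_neronSeveriGroup_eq_finrank_endAlgRat_of_isTorusSubgroup_mumfordTateGroupC hT]
  exact hX.finrank_endAlgRat_eq_card_iff_comm_of_isTorusSubgroup_mumfordTateGroupC hT

/-- **`dim A < ρ(A)` iff `End⁰(A)` is NOT commutative** (a repeated simple factor: `Bⱼ²` alone contributes
`ρ(Bⱼ²) = 4 dim Bⱼ > dim Bⱼ²`). [cite: HulekLaface2019PicardNumbersAV, §2.1 Prop. 2.4 (Type IV)] [cite: Shimura1998, §5.1 Props. 3–4, pp. 36–37] -/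
theorem card_lt_two_mul_finrank_neronSeveriGroup_iff_not_comm_of_isTorusSubgroup_mumfordTateGroupC
    [Literature.AlgebraicGeometry.Motives.HodgeTensorFacts.{0, 0}] [Nonempty ι]
    (hX : IsAbelianVariety P) (hT : IsTorusSubgroup (mumfordTateGroupC P)) :
    Fintype.card ι < 2 * finrank ℤ (neronSeveriGroup P) ↔ ¬ ∀ a b : endAlgRat P, a * b = b * a := by
  rw [hX.two_mul_finrank_neronSeveriGroup_eq_finrank_endAlgRat_of_isTorusSubgroup_mumfordTateGroupC hT]
  exact hX.card_lt_finrank_endAlgRat_iff_not_comm_of_isTorusSubgroup_mumfordTateGroupC hT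

/-- **A SIMPLE abelian variety of CM-type has `ρ(A) = dim A`** («`A` simple, `B¹(A) ≅ K₀`», `[K₀:ℚ] = dim A`; table line 4
with `d = 1`, `e₀ = g`). [cite: Gordon1999HodgeAVSurvey, 9.2.2] [cite: Lange2023AbelianVarietiesComplex, §2.6.1 Proposition, table line 4 (p. 138)]
[cite: Shimura1998, §5.1 Prop. 6, p. 38] -/
theorem two_mul_finrank_neronSeveriGroup_eq_card_of_isSimple_of_isTorusSubgroup_mumfordTateGroupC
    [Literature.AlgebraicGeometry.Motives.HodgeTensorFacts.{0, 0}] [Nonempty ι]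
    (hX : IsAbelianVariety P) (hS : IsSimple P) (hT : IsTorusSubgroup (mumfordTateGroupC P)) :
    2 * finrank ℤ (neronSeveriGroup P) = Fintype.card ι :=
  (hX.two_mul_finrank_neronSeveriGroup_eq_card_iff_comm_of_isTorusSubgroup_mumfordTateGroupC hT).2
    ((hX.isTorusSubgroup_mumfordTateGroupC_iff_of_isSimple hS).1 hT).1

/-- **`ρ(Aᵏ) = k² ρ(A)` for an abelian variety of CM-type** (`ρ(Xᵏ) = k ρ(X) + C(k,2)[End⁰X:ℚ]` with `[End⁰X:ℚ] = 2ρ(X)`;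
«Type IV: `ρ(Aᵏ) = ½ e d² k²`» summed over the isotypic components). [cite: HulekLaface2019PicardNumbersAV, §2.1 Prop. 2.4 and Cor. 2.3]
[cite: Lange2023AbelianVarietiesComplex, §2.6.1 Proposition, table line 4] -/
theorem finrank_neronSeveriGroup_powPeriod_eq_sq_mul_of_isTorusSubgroup_mumfordTateGroupC
    [Literature.AlgebraicGeometry.Motives.HodgeTensorFacts.{0, 0}] [Nonempty ι]
    (hX : IsAbelianVariety P) (hT : IsTorusSubgroup (mumfordTateGroupC P)) (k : ℕ) :
    finrank ℤ (neronSeveriGroup (powPeriod P k)) = k ^ 2 * finrank ℤ (neronSeveriGroup P) := by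
  rw [hX.finrank_neronSeveriGroup_pow k,
    ← hX.two_mul_finrank_neronSeveriGroup_eq_finrank_endAlgRat_of_isTorusSubgroup_mumfordTateGroupC hT]
  have key : k.choose 2 * 2 = k * (k - 1) := by
    rw [Nat.choose_two_right]
    exact Nat.div_two_mul_two_of_even (Nat.even_mul_pred_self k)
  rcases Nat.eq_zero_or_pos k with rfl | hk
  · simp
  · obtain ⟨k', rfl⟩ : ∃ k', k = k' + 1 := ⟨k - 1, (Nat.sub_add_cancel hk).symm⟩
    rw [Nat.add_sub_cancel] at key
    rw [← mul_assoc, key]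
    ring

/-- **`ρ(Aᵏ) = k² dim A` for a SIMPLE abelian variety of CM-type** (Murty / Hulek–Laface «Type IV: `ρ(Aᵏ) = ½ e d² k²`»
with `d = 1`, `e = 2 dim A`; written `2ρ(Aᵏ) = k² · #ι`). [cite: HulekLaface2019PicardNumbersAV, §2.1 Prop. 2.4 (Type IV)]
[cite: Gordon1999HodgeAVSurvey, 9.2.2] -/
theorem two_mul_finrank_neronSeveriGroup_powPeriod_eq_of_isSimple_of_isTorusSubgroup_mumfordTateGroupC
    [Literature.AlgebraicGeometry.Motives.HodgeTensorFacts.{0, 0}] [Nonempty ι]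
    (hX : IsAbelianVariety P) (hS : IsSimple P) (hT : IsTorusSubgroup (mumfordTateGroupC P)) (k : ℕ) :
    2 * finrank ℤ (neronSeveriGroup (powPeriod P k)) = k ^ 2 * Fintype.card ι := by
  rw [hX.finrank_neronSeveriGroup_powPeriod_eq_sq_mul_of_isTorusSubgroup_mumfordTateGroupC hT k, mul_left_comm,
    hX.two_mul_finrank_neronSeveriGroup_eq_card_of_isSimple_of_isTorusSubgroup_mumfordTateGroupC hS hT]

/-- **`[C(End⁰A):ℚ] ≤ 2ρ(A)`**, with equality iff `End⁰(A)` is commutative (`rdim A ≤ ρ(A)`: `Σⱼ[Kⱼ:ℚ] ≤ Σⱼ mⱼ²[Kⱼ:ℚ]`).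
[cite: Gordon1999HodgeAVSurvey, 7.4] [cite: Shimura1998, §5.1 Prop. 1, pp. 34–35] [cite: HulekLaface2019PicardNumbersAV, §2.1 Cor. 2.3] -/
theorem finrank_center_endAlgRat_le_two_mul_finrank_neronSeveriGroup_of_isTorusSubgroup_mumfordTateGroupC
    [Literature.AlgebraicGeometry.Motives.HodgeTensorFacts.{0, 0}] [Nonempty ι]
    (hX : IsAbelianVariety P) (hT : IsTorusSubgroup (mumfordTateGroupC P)) :
    finrank ℚ (Subalgebra.center ℚ (endAlgRat P)) ≤ 2 * finrank ℤ (neronSeveriGroup P) :=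
  (hX.finrank_center_endAlgRat_le_card_of_isTorusSubgroup_mumfordTateGroupC hT).trans
    (hX.card_le_two_mul_finrank_neronSeveriGroup_of_isTorusSubgroup_mumfordTateGroupC hT)

end IsAbelianVariety

/-! ### §3 The same from «`Hg(A)(ℂ)` is an algebraic torus» -/

namespace IsAbelianVariety

/-- `2ρ(A) = [End⁰(A):ℚ]`, from «`Hg(A)(ℂ)` is an algebraic torus». [cite: Gordon1997, §2 Prop. 2.12]
[cite: HulekLaface2019PicardNumbersAV, §2.1 Cor. 2.3 and Prop. 2.4] [cite: Lange2023AbelianVarietiesComplex, §2.6.1 Proposition] -/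
theorem two_mul_finrank_neronSeveriGroup_eq_finrank_endAlgRat_of_isTorusSubgroup_map_toGL_hodgeGroupC
    [Literature.AlgebraicGeometry.Motives.HodgeTensorFacts.{0, 0}] [Nonempty ι]
    (hX : IsAbelianVariety P) (hT : IsTorusSubgroup ((hodgeGroupC P).map Matrix.SpecialLinearGroup.toGL)) :
    2 * finrank ℤ (neronSeveriGroup P) = finrank ℚ (endAlgRat P) :=
  hX.two_mul_finrank_neronSeveriGroup_eq_finrank_endAlgRat_of_isTorusSubgroup_mumfordTateGroupC
    ((isTorusSubgroup_mumfordTateGroupC_iff_map_toGL_hodgeGroupC P).2 hT)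

/-- `dim A ≤ ρ(A)`, from «`Hg(A)(ℂ)` is an algebraic torus». [cite: Gordon1997, §2 Prop. 2.12]
[cite: HulekLaface2019PicardNumbersAV, §2.1 Prop. 2.4] -/
theorem card_le_two_mul_finrank_neronSeveriGroup_of_isTorusSubgroup_map_toGL_hodgeGroupC
    [Literature.AlgebraicGeometry.Motives.HodgeTensorFacts.{0, 0}] [Nonempty ι]
    (hX : IsAbelianVariety P) (hT : IsTorusSubgroup ((hodgeGroupC P).map Matrix.SpecialLinearGroup.toGL)) :
    Fintype.card ι ≤ 2 * finrank ℤ (neronSeveriGroup P) :=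
  hX.card_le_two_mul_finrank_neronSeveriGroup_of_isTorusSubgroup_mumfordTateGroupC
    ((isTorusSubgroup_mumfordTateGroupC_iff_map_toGL_hodgeGroupC P).2 hT)

/-- `ρ(A) = dim A ⟺ End⁰(A)` commutative, from «`Hg(A)(ℂ)` is an algebraic torus». [cite: Gordon1997, §2 Prop. 2.12]
[cite: Lange2023AbelianVarietiesComplex, §2.6.1 Proposition, table line 4] -/
theorem two_mul_finrank_neronSeveriGroup_eq_card_iff_comm_of_isTorusSubgroup_map_toGL_hodgeGroupC
    [Literature.AlgebraicGeometry.Motives.HodgeTensorFacts.{0, 0}] [Nonempty ι]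
    (hX : IsAbelianVariety P) (hT : IsTorusSubgroup ((hodgeGroupC P).map Matrix.SpecialLinearGroup.toGL)) :
    2 * finrank ℤ (neronSeveriGroup P) = Fintype.card ι ↔ ∀ a b : endAlgRat P, a * b = b * a :=
  hX.two_mul_finrank_neronSeveriGroup_eq_card_iff_comm_of_isTorusSubgroup_mumfordTateGroupC
    ((isTorusSubgroup_mumfordTateGroupC_iff_map_toGL_hodgeGroupC P).2 hT)

/-- `ρ(A) = dim A` for `A` simple, from «`Hg(A)(ℂ)` is an algebraic torus». [cite: Gordon1997, §2 Prop. 2.12]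
[cite: Gordon1999HodgeAVSurvey, 9.2.2] -/
theorem two_mul_finrank_neronSeveriGroup_eq_card_of_isSimple_of_isTorusSubgroup_map_toGL_hodgeGroupC
    [Literature.AlgebraicGeometry.Motives.HodgeTensorFacts.{0, 0}] [Nonempty ι]
    (hX : IsAbelianVariety P) (hS : IsSimple P)
    (hT : IsTorusSubgroup ((hodgeGroupC P).map Matrix.SpecialLinearGroup.toGL)) :
    2 * finrank ℤ (neronSeveriGroup P) = Fintype.card ι :=
  hX.two_mul_finrank_neronSeveriGroup_eq_card_of_isSimple_of_isTorusSubgroup_mumfordTateGroupC hS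
    ((isTorusSubgroup_mumfordTateGroupC_iff_map_toGL_hodgeGroupC P).2 hT)

/-- `ρ(Aᵏ) = k² ρ(A)`, from «`Hg(A)(ℂ)` is an algebraic torus». [cite: Gordon1997, §2 Prop. 2.12]
[cite: HulekLaface2019PicardNumbersAV, §2.1 Prop. 2.4 and Cor. 2.3] -/
theorem finrank_neronSeveriGroup_powPeriod_eq_sq_mul_of_isTorusSubgroup_map_toGL_hodgeGroupC
    [Literature.AlgebraicGeometry.Motives.HodgeTensorFacts.{0, 0}] [Nonempty ι]
    (hX : IsAbelianVariety P) (hT : IsTorusSubgroup ((hodgeGroupC P).map Matrix.SpecialLinearGroup.toGL)) (k : ℕ) :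
    finrank ℤ (neronSeveriGroup (powPeriod P k)) = k ^ 2 * finrank ℤ (neronSeveriGroup P) :=
  hX.finrank_neronSeveriGroup_powPeriod_eq_sq_mul_of_isTorusSubgroup_mumfordTateGroupC
    ((isTorusSubgroup_mumfordTateGroupC_iff_map_toGL_hodgeGroupC P).2 hT) k

end IsAbelianVariety

end Literature.Geometry.Kaehler.ComplexTorus
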